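import Literature.AlgebraicGeometry.NeronModels.DilatationAffine
import HarnessLib

/-!
# Dilatations of schemes: the dilatation is an open subscheme of the blowing up (MRR §2.2)

Topic: `Literature/AlgebraicGeometry/NeronModels`; sequel of `Dilatation.lean` (`IsDilatation`,
`IsDilatation.toBlowup`) and `DilatationAffine.lean` (`Spec A[I/b] → Spec A` is a dilatation).
Mayeux–Richarz–Romagny, arXiv:2001.03597, §2.2, first Lemma: "The affine blowup `Bl_Z^D X` is the
open subscheme of the blowup `Bl_Z X = Proj(Bl_𝓘 𝒪_X)` defined by the complement of `V₊(𝒥)`",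
proof: "We reduce to the case where `X = Spec(B)` is affine and `J = (b)` is principal. Then
`B[I/b]` is the homogeneous localization of `B ⊕ I ⊕ I² ⊕ …` at `b ∈ I` viewed as an element in
degree `1`. This shows that `Spec(B[I/b])` is the complement of `V₊(b)` in `Proj(Bl_I B)`."

PROVED here in that affine principal case, for the tree's objects: the chart
`D₊(bt) = Spec (A[It])_{(bt)} ↪ Bl_I(Spec A) = Proj A[It]` (`Resolution.affineBlowup.chartι`, an
open immersion with image `D₊(bt)`) composed with the identification
`(A[It])_{(bt)} ≅ A[I/b]` (`Resolution.reesChartEquiv`, Stacks 0804) is an `X`-morphism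
`Spec A[I/b] → Bl_I(Spec A)`, hence IS the canonical morphism `IsDilatation.toBlowup` of the
dilatation to the blowing up (uniqueness of `X`-morphisms into a blowing up); consequently
`toBlowup` is an open immersion with image `D₊(bt)` — for the constructed pair
(`toBlowup_eq`, `isOpenImmersion_toBlowup_spec`, `range_toBlowup_spec`) and, by uniqueness
of dilatations and blowing ups up to `X`-isomorphism, for ANY dilatation of `Spec A` in `V(I)`
along `V(b)` and ANY blowing up of `Spec A` along `V(I)` (`isOpenImmersion_toBlowup`); then the
GENERAL case by MRR's reduction ("Our claim is Zariski local on `X`. We reduce to the case where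
`X = Spec(B)` is affine and `J = (b)` is principal"): for a dilatation `π : X' → X` of any scheme
`X` in `Z` along a locally principal `D ⊇ Z` (`∀ x, ∃` affine open `U ∋ x` with `D(U)` principal)
and a blowing up `p : B → X` of `X` along `Z`, **the canonical `X`-morphism `X' → B` is an open
immersion** (`IsDilatation.isOpenImmersion_toBlowup`; composite form
`isOpenImmersion_of_isDilatation_comp`) — open immersions are Zariski local on the target, and
over an affine open `U ⊆ X` with `D(U) = (b₀)` one transports along `U ≅ Spec Γ(U, 𝒪)` to the
affine statement (`isOpenImmersion_of_isAffine_of_ideal_top_eq_span`). Also: transport of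
`IsDilatation` along isomorphisms of source and target (`IsDilatation.iso_comp`, `comp_iso`).
The identification of the image with the complement of `V₊(𝒥)` is recorded only in the affine
case (`range_toBlowup_spec`: the image is `D₊(bt)`).

## References

* A. Mayeux, T. Richarz, M. Romagny, *Néron blowups and low-degree cohomological applications*,
  arXiv:2001.03597 (2020), §2.2 (first Lemma). [MayeuxRicharzRomagny2020]
* The Stacks Project, Tag 0804 (`D₊(a^{(1)}) = Spec R[I/a]`). [StacksProject]
-/

noncomputable section

open CategoryTheory CategoryTheory.Limits AlgebraicGeometry TopologicalSpace
open Literature.AlgebraicGeometry.Resolution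

namespace Literature.AlgebraicGeometry.NeronModels

universe u

/-! ## Transport along isomorphisms -/

namespace IsDilatation

variable {X' X : Scheme.{u}} {π : X' ⟶ X} {Z D : X.IdealSheafData}

/-- A dilatation precomposed with an isomorphism is a dilatation. [folklore] -/
theorem iso_comp {X'' : Scheme.{u}} (h : IsDilatation π Z D) (e : X'' ≅ X') :
    IsDilatation (e.hom ≫ π) Z D := by
  refine ⟨?_, h.comap_comp_le e.hom, ?_⟩
  · rw [Scheme.IdealSheafData.comap_comp]
    exact h.isEffectiveCartier.comap_iso e
  · intro T f hf hZ
    obtain ⟨g, hg, hgu⟩ := h.universal f hf hZ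
    refine ⟨g ≫ e.inv, by simpa using hg, fun g' hg' => ?_⟩
    have hg' : g' ≫ e.hom ≫ π = f := hg'
    rw [← hgu (g' ≫ e.hom) (by simpa using hg'), Category.assoc, e.hom_inv_id, Category.comp_id]

/-- A dilatation postcomposed with an isomorphism of the base is a dilatation of the new base
in the transported centre along the transported divisor. [folklore] -/
theorem comp_iso {Y : Scheme.{u}} (h : IsDilatation π Z D) (e : X ≅ Y) :
    IsDilatation (π ≫ e.hom) (Z.comap e.inv) (D.comap e.inv) := by
  have hc : ∀ (K : X.IdealSheafData) {T : Scheme.{u}} (f : T ⟶ Y),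
      (K.comap e.inv).comap f = K.comap (f ≫ e.inv) := fun K T f => by
    rw [Scheme.IdealSheafData.comap_comp]
  have hπ : (π ≫ e.hom) ≫ e.inv = π := by simp
  refine ⟨?_, ?_, ?_⟩
  · rw [hc, hπ]
    exact h.isEffectiveCartier
  · rw [hc, hc, hπ]
    exact h.comap_le
  · intro T f hf hZ
    rw [hc] at hf
    rw [hc, hc] at hZ
    obtain ⟨g, hg, hgu⟩ := h.universal (f ≫ e.inv) hf hZ
    refine ⟨g, ?_, fun g' hg' => hgu g' ?_⟩
    · change g ≫ π ≫ e.hom = f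
      rw [reassoc_of% hg, e.inv_hom_id, Category.comp_id]
    · have hg' : g' ≫ π ≫ e.hom = f := hg'
      rw [← hg', Category.assoc, Category.assoc, e.hom_inv_id, Category.comp_id]

end IsDilatation

/-! ## The chart `Spec A[I/b] ≅ D₊(bt) ⊆ Bl_I(Spec A)` is the canonical morphism -/

section Affine

variable {A : Type u} [CommRing A] (I : Ideal A) {b : A}

/-- `Ĩ_{(b)} ≤ Ĩ_I` on `Spec A` for `b ∈ I` (i.e. `V(I) ⊆ V(b)`, MRR's standing assumption
`Z ⊆ D`). [folklore] -/
theorem idealSheaf_span_le (hb : b ∈ I) :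
    affineBlowup.idealSheaf (Ideal.span {b}) ≤ affineBlowup.idealSheaf I := by
  unfold affineBlowup.idealSheaf
  refine Scheme.IdealSheafData.le_of_isAffine ?_
  rw [ideal_ofIdealTop_top, ideal_ofIdealTop_top]
  exact Ideal.map_mono (Ideal.span_le.mpr (Set.singleton_subset_iff.mpr hb))

/-- **The chart morphism `Spec A[I/b] → Bl_I(Spec A)`**: the open immersion
`D₊(bt) = Spec (A[It])_{(bt)} ↪ Proj A[It]` precomposed with `Spec` of the isomorphism
`(A[It])_{(bt)} ≅ A[I/b]` (Stacks 0804: "`D₊(a^{(1)}) = Spec R[I/a]`"). An open immersion (an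
isomorphism followed by an open immersion). [cite: StacksProject, Tag 0804] -/
theorem isOpenImmersion_chart (hb : b ∈ I) :
    IsOpenImmersion (Spec.map (reesChartEquiv b hb).toCommRingCatIso.hom ≫
      affineBlowup.chartι (I := I) b hb) :=
  inferInstance

/-- The chart morphism is a morphism over `Spec A`: followed by `Bl_I(Spec A) → Spec A` it is
the dilatation morphism `Spec A[I/b] → Spec A`. [cite: StacksProject, Tag 0804] -/
theorem chart_comp_π (hb : b ∈ I) :
    (Spec.map (reesChartEquiv b hb).toCommRingCatIso.hom ≫ affineBlowup.chartι (I := I) b hb) ≫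
        affineBlowup.π I =
      Spec.map (CommRingCat.ofHom (algebraMap A (blowupAlgebra I b))) := by
  rw [Category.assoc, affineBlowup.chartι_π, ← Spec.map_comp, RingEquiv.toCommRingCatIso_hom,
    ← CommRingCat.ofHom_comp]
  congr 2
  rw [← reesChartEquiv_comp_reesChartBase b hb]
  rfl

/-- The image of the chart morphism is `D₊(bt)`. [cite: StacksProject, Tag 0804] -/
theorem opensRange_chart (hb : b ∈ I) :
    (Spec.map (reesChartEquiv b hb).toCommRingCatIso.hom ≫
        affineBlowup.chartι (I := I) b hb).opensRange =
      Proj.basicOpen (reesGrading I) (reesT b hb) := by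
  rw [Scheme.Hom.opensRange_comp_of_isIso, ← Scheme.Hom.image_top_eq_opensRange]
  exact affineBlowup.image_top_chartι b hb

/-- **MRR §2.2, first Lemma, for the constructed objects**: the canonical `X`-morphism from the
dilatation `Spec A[I/b]` to the blowing up `Bl_I(Spec A) = Proj A[It]` (`IsDilatation.toBlowup`)
is the chart morphism `Spec A[I/b] ≅ D₊(bt) ↪ Proj A[It]` — both are `X`-morphisms into the
blowing up from a scheme on which `V(I)` pulls back to an effective Cartier divisor.
[cite: MayeuxRicharzRomagny2020, §2.2 (Lemma)] -/
theorem toBlowup_eq (hb : b ∈ I) :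
    (isDilatation_specMap_blowupAlgebra I b).toBlowup (affineBlowup.isBlowup I)
        (idealSheaf_span_le I hb) =
      Spec.map (reesChartEquiv b hb).toCommRingCatIso.hom ≫ affineBlowup.chartι (I := I) b hb :=
  ((isDilatation_specMap_blowupAlgebra I b).toBlowup_unique (affineBlowup.isBlowup I) _
    (chart_comp_π I hb)).symm

/-- **The dilatation `Spec A[I/b]` is an open subscheme of the blowing up `Bl_I(Spec A)`**
(MRR §2.2, first Lemma, affine principal case): the canonical morphism is an open immersion …
[cite: MayeuxRicharzRomagny2020, §2.2 (Lemma)] -/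
theorem isOpenImmersion_toBlowup_spec (hb : b ∈ I) :
    IsOpenImmersion ((isDilatation_specMap_blowupAlgebra I b).toBlowup (affineBlowup.isBlowup I)
      (idealSheaf_span_le I hb)) := by
  rw [toBlowup_eq I hb]
  infer_instance

/-- … with image the complement `D₊(bt)` of `V₊(bt)` ("defined by the complement of `V₊(𝒥)`").
[cite: MayeuxRicharzRomagny2020, §2.2 (Lemma)] -/
theorem range_toBlowup_spec (hb : b ∈ I) :
    Set.range ((isDilatation_specMap_blowupAlgebra I b).toBlowup (affineBlowup.isBlowup I)
        (idealSheaf_span_le I hb)) =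
      (Proj.basicOpen (reesGrading I) (reesT b hb) : Set (affineBlowup I)) := by
  rw [toBlowup_eq I hb, ← opensRange_chart I hb, Scheme.Hom.coe_opensRange]

/-- **MRR §2.2, first Lemma, over an affine base with principal divisor**: for ANY dilatation
`π : X' → Spec A` of `Spec A` in `V(I)` along `V(b)`, `b ∈ I`, and ANY blowing up
`p : B → Spec A` of `Spec A` along `V(I)`, the canonical `X`-morphism `X' → B` is an open
immersion — by uniqueness of both objects up to `X`-isomorphism it is conjugate to the chart
`Spec A[I/b] ≅ D₊(bt) ↪ Proj A[It]`. [cite: MayeuxRicharzRomagny2020, §2.2 (Lemma)] -/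
theorem isOpenImmersion_toBlowup (hb : b ∈ I) {X' B : Scheme.{u}} {π : X' ⟶ Spec (.of A)}
    {p : B ⟶ Spec (.of A)} (h : IsDilatation π (affineBlowup.idealSheaf I)
      (affineBlowup.idealSheaf (Ideal.span {b})))
    (hB : IsBlowup p (affineBlowup.idealSheaf I)) :
    IsOpenImmersion (h.toBlowup hB (idealSheaf_span_le I hb)) := by
  obtain ⟨e₁, he₁, -⟩ := h.unique (isDilatation_specMap_blowupAlgebra I b)
  obtain ⟨e₂, -, he₂⟩ := hB.unique (affineBlowup.isBlowup I)
  set j := Spec.map (reesChartEquiv b hb).toCommRingCatIso.hom ≫ affineBlowup.chartι (I := I) b hb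
  have hj : (e₁.hom ≫ j ≫ e₂.inv) ≫ p = π := by
    simp only [Category.assoc, he₂]
    rw [chart_comp_π I hb, he₁]
  rw [← h.toBlowup_unique hB (idealSheaf_span_le I hb) hj]
  infer_instance

end Affine

/-! ## The general case: `Bl_Z^D X ⊆ Bl_Z X` is open, for `D` locally principal -/

section General

variable {X' B X : Scheme.{u}} {p : B ⟶ X} {Z D : X.IdealSheafData}

/-- The top ideal of the restriction `K|_U` of an ideal sheaf to an affine open `U` is `K(U)`,
moved along `Γ(U, ⊤) ≅ Γ(X, U)` (same statement as `Resolution.ideal_top_comap_ι` of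
`MarkedIdealsLemmas.lean`, whose imports are much heavier than this file's). [folklore] -/
theorem comap_ι_ideal_top (K : X.IdealSheafData) (U : X.affineOpens) :
    haveI : IsAffine (U : X.Opens) := U.2
    (K.comap (U : X.Opens).ι).ideal ⟨⊤, isAffineOpen_top _⟩ =
      (K.ideal U).map (U : X.Opens).topIso.inv.hom := by
  haveI : IsAffine (U : X.Opens) := U.2
  rw [Scheme.IdealSheafData.ideal_comap_of_isOpenImmersion, Scheme.Opens.ι_appIso, Iso.refl_inv,
    ← K.map_ideal' (U := ⟨(U : X.Opens).ι ''ᵁ ⊤, (isAffineOpen_top _).image_of_isOpenImmersion _⟩)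
      (V := U) (eqToIso (U : X.Opens).ι_image_top.symm).op.inv]
  exact Ideal.comap_id _

/-- **Ideal sheaves on an affine scheme, moved to `Spec Γ(X, 𝒪_X)`**: along the canonical
isomorphism `e : X ≅ Spec Γ(X, 𝒪_X)` (Mathlib's `Scheme.isoSpec`), the ideal sheaf `K` becomes the
ideal sheaf `Ĩ` (`Resolution.affineBlowup.idealSheaf`) of the ideal
`I = Γ(X, K) ⊆ Γ(X, 𝒪_X)` moved along `e⁻¹* : Γ(X, 𝒪) → Γ(Spec Γ(X, 𝒪), 𝒪) ≅ Γ(X, 𝒪)`. [folklore] -/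
theorem comap_isoSpec_inv [IsAffine X] (K : X.IdealSheafData) :
    K.comap X.isoSpec.inv = affineBlowup.idealSheaf
      (((K.ideal ⟨⊤, isAffineOpen_top X⟩).map X.isoSpec.inv.appTop.hom).map
        (Scheme.ΓSpecIso (.of Γ(X, ⊤))).hom.hom) := by
  have hK0 : K = Scheme.IdealSheafData.ofIdealTop (K.ideal ⟨⊤, isAffineOpen_top X⟩) :=
    (Scheme.IdealSheafData.ext_of_isAffine (by rw [ideal_ofIdealTop_top])).symm
  have hid : (Scheme.ΓSpecIso (.of Γ(X, ⊤))).inv.hom.comp (Scheme.ΓSpecIso (.of Γ(X, ⊤))).hom.hom =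
      RingHom.id _ := by
    rw [← CommRingCat.hom_comp, Iso.hom_inv_id, CommRingCat.hom_id]
  conv_lhs => rw [hK0, comap_ofIdealTop_of_isAffine]
  rw [affineBlowup.idealSheaf, Ideal.map_map, hid]
  congr 1
  exact (Ideal.map_id _).symm

/-- **MRR §2.2, first Lemma, over an affine base on which `D` is principal**: if `g ≫ p` is a
dilatation of the affine scheme `X` in `Z` along `D = V(b₀)`, `b₀ ∈ Γ(X, 𝒪_X)`, with `Z ⊆ D`, and
`p` is a blowing up of `X` along `Z`, then `g` is an open immersion — transport along
`X ≅ Spec Γ(X, 𝒪_X)` to `isOpenImmersion_toBlowup`. [cite: MayeuxRicharzRomagny2020, §2.2 (Lemma)] -/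
theorem isOpenImmersion_of_isAffine_of_ideal_top_eq_span [IsAffine X] {g : X' ⟶ B}
    (h : IsDilatation (g ≫ p) Z D) (hB : IsBlowup p Z) (hZD : D ≤ Z) {b₀ : Γ(X, ⊤)}
    (hb₀ : D.ideal ⟨⊤, isAffineOpen_top X⟩ = Ideal.span {b₀}) : IsOpenImmersion g := by
  -- transport everything to `Spec R`, `R = Γ(X, 𝒪_X)`
  let e := X.isoSpec
  let a : Γ(X, ⊤) →+* Γ(Spec Γ(X, ⊤), ⊤) := e.inv.appTop.hom
  let ι : Γ(Spec Γ(X, ⊤), ⊤) →+* Γ(X, ⊤) := (Scheme.ΓSpecIso (.of Γ(X, ⊤))).hom.hom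
  let I₀ : Ideal Γ(X, ⊤) := ((Z.ideal ⟨⊤, isAffineOpen_top X⟩).map a).map ι
  let b₁ : Γ(X, ⊤) := ι (a b₀)
  have hZ : Z.comap e.inv = affineBlowup.idealSheaf I₀ := comap_isoSpec_inv Z
  have hD : D.comap e.inv = affineBlowup.idealSheaf (Ideal.span {b₁}) := by
    rw [comap_isoSpec_inv D, hb₀, Ideal.map_span, Set.image_singleton, Ideal.map_span,
      Set.image_singleton]
  have hbD : b₀ ∈ D.ideal ⟨⊤, isAffineOpen_top X⟩ := by
    rw [hb₀]
    exact Ideal.mem_span_singleton_self b₀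
  have hb₁ : b₁ ∈ I₀ :=
    Ideal.mem_map_of_mem _ (Ideal.mem_map_of_mem _ (hZD ⟨⊤, isAffineOpen_top X⟩ hbD))
  have h' : IsDilatation ((g ≫ p) ≫ e.hom) (affineBlowup.idealSheaf I₀)
      (affineBlowup.idealSheaf (Ideal.span {b₁})) := by
    rw [← hZ, ← hD]
    exact h.comp_iso e
  have hB' : IsBlowup (p ≫ e.hom) (affineBlowup.idealSheaf I₀) := by
    rw [← hZ]
    exact hB.comp_iso e
  have hoi := isOpenImmersion_toBlowup I₀ hb₁ h' hB'
  rwa [← h'.toBlowup_unique hB' (idealSheaf_span_le I₀ hb₁) (Category.assoc g p e.hom).symm]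
    at hoi

/-- **The dilatation is an open subscheme of the blowing up** (Mayeux–Richarz–Romagny §2.2,
first Lemma: "The affine blowup `Bl_Z^D X` is the open subscheme of the blowup `Bl_Z X` defined
by the complement of `V₊(𝒥)`"; "Our claim is Zariski local on `X`. We reduce to the case where
`X = Spec(B)` is affine and `J = (b)` is principal"), composite form: if `g ≫ p` is a dilatation
of `X` in `Z` along a LOCALLY PRINCIPAL `D` with `Z ⊆ D`, and `p : B → X` is a blowing up of `X`
along `Z`, then `g : X' → B` is an open immersion — open immersions are Zariski local on the
target `B`, and over an affine open `U ⊆ X` on which `D` is principal, `g` restricted over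
`p⁻¹U` is in the situation of `isOpenImmersion_of_isAffine_of_ideal_top_eq_span` for the
restricted dilatation and blowing up of `U`. [cite: MayeuxRicharzRomagny2020, §2.2 (Lemma)] -/
theorem isOpenImmersion_of_isDilatation_comp {g : X' ⟶ B} (h : IsDilatation (g ≫ p) Z D)
    (hB : IsBlowup p Z) (hZD : D ≤ Z)
    (hD : ∀ x : X, ∃ U : X.affineOpens, x ∈ (U : X.Opens) ∧
      ∃ b : Γ(X, U), D.ideal U = Ideal.span {b}) :
    IsOpenImmersion g := by
  choose U hxU b hbU using hD
  have hcover : ⨆ x, (U x : X.Opens) = ⊤ :=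
    top_le_iff.mp fun x _ => Opens.mem_iSup.mpr ⟨x, hxU x⟩
  have hcover' : ⨆ x, p ⁻¹ᵁ (U x : X.Opens) = ⊤ := by
    rw [← Scheme.Hom.preimage_iSup, hcover, Scheme.Hom.preimage_top]
  refine IsZariskiLocalAtTarget.of_iSup_eq_top (P := @IsOpenImmersion) _ hcover' fun x => ?_
  haveI : IsAffine ((U x : X.Opens) : Scheme.{u}) := (U x).2
  -- over `U x`: the restricted dilatation `(g ≫ p) ∣_ U = g ∣_ (p⁻¹ U) ≫ p ∣_ U` and blowing up
  have hπ : IsDilatation ((g ∣_ p ⁻¹ᵁ (U x : X.Opens)) ≫ (p ∣_ (U x : X.Opens)))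
      (Z.comap (U x : X.Opens).ι) (D.comap (U x : X.Opens).ι) := by
    rw [← morphismRestrict_comp]
    exact h.restrict _
  refine isOpenImmersion_of_isAffine_of_ideal_top_eq_span hπ (hB.restrict _)
    (Scheme.IdealSheafData.comap_mono _ hZD) (b₀ := (U x : X.Opens).topIso.inv.hom (b x)) ?_
  rw [comap_ι_ideal_top D (U x), hbU, Ideal.map_span, Set.image_singleton]

/-- **The dilatation is an open subscheme of the blowing up** (Mayeux–Richarz–Romagny §2.2,
first Lemma), for the canonical morphism `IsDilatation.toBlowup : X' → B` from a dilatation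
`π : X' → X` of `X` in `Z` along a locally principal `D ⊇ Z` to a blowing up `p : B → X` of `X`
along `Z`: it is an open immersion. [cite: MayeuxRicharzRomagny2020, §2.2 (Lemma)] -/
theorem IsDilatation.isOpenImmersion_toBlowup {π : X' ⟶ X} (h : IsDilatation π Z D)
    (hB : IsBlowup p Z) (hZD : D ≤ Z)
    (hD : ∀ x : X, ∃ U : X.affineOpens, x ∈ (U : X.Opens) ∧
      ∃ b : Γ(X, U), D.ideal U = Ideal.span {b}) :
    IsOpenImmersion (h.toBlowup hB hZD) := by
  have h' : IsDilatation (h.toBlowup hB hZD ≫ p) Z D := by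
    rw [h.toBlowup_comp]
    exact h
  exact isOpenImmersion_of_isDilatation_comp h' hB hZD hD

end General

end Literature.AlgebraicGeometry.NeronModels

end
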